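import Summits.AtomisticToContinuum.Crystallization.Theses.BrittleRungDescent
import Literature.MathematicalPhysics.StatisticalMechanics.LennardJonesClusters

/-!
# Route BrittleRungDescent — the brittle rung `MieRung` from the rung chain (bookkeeping glue)

Item `stmt-AtomisticToContinuum-10946` (`MieRung`, support/milestone of route `BrittleRungDescent`,
shared with route `OneCentreSteepnessLadder`) is the three-dimensional crystallization statement for
the Mie `(2q, q)` pair potentials, `∃ q₀, ∀ q ≥ q₀, HasPeriodicGroundStateEnergy (miePotential q) 3 ∧
IsCrystallizing (miePotential q) 3` — an OPEN PROBLEM as stated (Blanc–Lewin 2015, §2.3; Flatley–Theil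
2015, Conj. 2.2).  In the route it is closed only through the glue item `RungAssembly`:
`SoftLocalHales → LadderGroundStates → MieSoftKissing → BrittleBarlowRigidity → MieRung`.

This file proves that glue, i.e. the CONDITIONAL form of the rung:

* `mieRung_of_rung_chain : SoftLocalHales → LadderGroundStates → MieSoftKissing →
  BrittleBarlowRigidity → MieRung`.

The argument is the planner's bookkeeping (route docstring, item RungAssembly): with `η₀` from
`SoftLocalHales`, `(η₁, p₁)` from `BrittleBarlowRigidity` and `η = min η₀ η₁ ≤ 1/100`, take `p₀(η)` from
`MieSoftKissing` and `q ≥ max p₀ p₁ q₀ 4`.  Soft kissing and the soft contact graphs are monotone in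
the tolerance below the Hales gap `63/50` (`kissed_mono`, `dist_le_iff_of_dichotomy`); an atom all of
whose `η`-neighbours are `η`-kissed gets an fcc/hcp shell graph from `SoftLocalHales` applied to the
point SET of the (injective) ground state (`kissed_range_of_kissed`, `shellIso_transport`); hence an
atom whose `6`-ball consists of `η`-kissed atoms is good in the sense of `BrittleBarlowRigidity`
(`good_of_ball_kissed`), and by packing (separation `1 - 2/q ≥ 1/2` from `LadderGroundStates`,
`card_le_of_separated_of_dist_le`) the bad atoms number at most `25³ ×` the non-`η`-kissed ones
(`natCard_not_le_mul_natCard_not`), which are `o(N)` by `MieSoftKissing`.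
-/

noncomputable section

namespace Summit.AtomisticToContinuum.Crystallization.Theorems.BrittleRungDescentMieRung

open Filter Topology
open Literature.MathematicalPhysics.StatisticalMechanics Literature.Geometry.DiscreteGeometry
open Summit.AtomisticToContinuum.Crystallization.Theses.BrittleRungDescent

/-! ### Tolerance monotonicity below the gap -/

/-- Below the Hales gap the neighbour relation does not depend on the tolerance: if `a ≤ 1 + t` or
`63/50 ≤ a` (the dichotomy of a `t`-kissed atom) and `t ≤ t'` with `1 + t' < 63/50`, then
`a ≤ 1 + t' ↔ a ≤ 1 + t`. [folklore] -/
theorem dist_le_iff_of_dichotomy {a t t' : ℝ} (htt' : t ≤ t') (ht' : 1 + t' < 63 / 50)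
    (h : a ≤ 1 + t ∨ 63 / 50 ≤ a) : a ≤ 1 + t' ↔ a ≤ 1 + t := by
  refine ⟨fun ha => ?_, fun ha => ha.trans (by linarith)⟩
  rcases h with h | h
  · exact h
  · exact absurd (h.trans ha) (not_le.2 ht')

/-- **Soft kissing is monotone in the tolerance below the gap.** If atom `j` of the configuration
`y` is softly twelve-kissed with tolerance `t` (all others at distance `≥ 1 - t`, each either within
`1 + t` or beyond `63/50`, exactly twelve within `1 + t`), then it is softly twelve-kissed with every
tolerance `t' ∈ [t, 13/50)` — with the same twelve neighbours. [folklore] -/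
theorem kissed_mono {N : ℕ} (y : Fin N → EuclideanSpace ℝ (Fin 3)) {t t' : ℝ} (htt' : t ≤ t')
    (ht' : 1 + t' < 63 / 50) (j : Fin N)
    (hj : (∀ l : Fin N, l ≠ j → (1 - t) ≤ dist (y j) (y l) ∧
        (dist (y j) (y l) ≤ (1 + t) ∨ 63 / 50 ≤ dist (y j) (y l))) ∧
      Nat.card {l : Fin N // l ≠ j ∧ dist (y j) (y l) ≤ (1 + t)} = 12) :
    (∀ l : Fin N, l ≠ j → (1 - t') ≤ dist (y j) (y l) ∧
        (dist (y j) (y l) ≤ (1 + t') ∨ 63 / 50 ≤ dist (y j) (y l))) ∧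
      Nat.card {l : Fin N // l ≠ j ∧ dist (y j) (y l) ≤ (1 + t')} = 12 := by
  refine ⟨fun l hl => ?_, ?_⟩
  · obtain ⟨h1, h2⟩ := hj.1 l hl
    refine ⟨by linarith, ?_⟩
    rcases h2 with h2 | h2
    · exact Or.inl (h2.trans (by linarith))
    · exact Or.inr h2
  · rw [← hj.2]
    refine Nat.card_congr (Equiv.subtypeEquivRight fun l => ?_)
    refine ⟨fun h => ⟨h.1, ?_⟩, fun h => ⟨h.1, h.2.trans (by linarith)⟩⟩
    exact (dist_le_iff_of_dichotomy htt' ht' (hj.1 l h.1).2).1 h.2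

/-! ### From indices to the point set -/

/-- An atom that is softly twelve-kissed in the injective configuration `y` (index form) is softly
twelve-kissed as a point of the SET `range y` (the form of `SoftLocalHales`). [folklore] -/
theorem kissed_range_of_kissed {N : ℕ} {y : Fin N → EuclideanSpace ℝ (Fin 3)}
    (hy : Function.Injective y) {t : ℝ} {m : Fin N}
    (hm : (∀ l : Fin N, l ≠ m → (1 - t) ≤ dist (y m) (y l) ∧
        (dist (y m) (y l) ≤ (1 + t) ∨ 63 / 50 ≤ dist (y m) (y l))) ∧
      Nat.card {l : Fin N // l ≠ m ∧ dist (y m) (y l) ≤ (1 + t)} = 12) :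
    (∀ w ∈ Set.range y, w ≠ y m → 1 - t ≤ dist (y m) w ∧
        (dist (y m) w ≤ 1 + t ∨ 63 / 50 ≤ dist (y m) w)) ∧
      {w ∈ Set.range y | w ≠ y m ∧ dist (y m) w ≤ 1 + t}.ncard = 12 := by
  refine ⟨?_, ?_⟩
  · rintro w ⟨l, rfl⟩ hne
    exact hm.1 l fun h => hne (h ▸ rfl)
  · have hset : {w ∈ Set.range y | w ≠ y m ∧ dist (y m) w ≤ 1 + t} =
        y '' {l : Fin N | l ≠ m ∧ dist (y m) (y l) ≤ 1 + t} := by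
      ext w
      constructor
      · rintro ⟨⟨l, rfl⟩, hne, hd⟩
        exact ⟨l, ⟨fun h => hne (h ▸ rfl), hd⟩, rfl⟩
      · rintro ⟨l, ⟨hne, hd⟩, rfl⟩
        exact ⟨⟨l, rfl⟩, hy.ne hne, hd⟩
    rw [hset, Set.ncard_image_of_injective _ hy, ← Nat.card_coe_set_eq]
    exact hm.2

/-! ### Transport of the shell graph -/

/-- **Transport of the soft contact graph from the point set back to indices, and up in the
tolerance.** Let `j` be `t`-kissed and let every `t`-neighbour of `j` be `t`-kissed.  If the soft
contact graph (pairs within `1 + t`) on the `t`-neighbours of the POINT `y j` in `range y` is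
isomorphic to the contact graph of the pattern `pat`, then so is the soft contact graph at any
tolerance `t' ∈ [t, 13/50)` on the `t'`-neighbour INDICES of `j` (same atoms, same graph, by the
gap dichotomy). [folklore] -/
theorem shellIso_transport {N : ℕ} {y : Fin N → EuclideanSpace ℝ (Fin 3)}
    (hy : Function.Injective y) {t t' : ℝ} (htt' : t ≤ t') (ht' : 1 + t' < 63 / 50) (j : Fin N)
    (hj : ∀ l : Fin N, l ≠ j → (1 - t) ≤ dist (y j) (y l) ∧
        (dist (y j) (y l) ≤ (1 + t) ∨ 63 / 50 ≤ dist (y j) (y l)))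
    (hnb : ∀ k : Fin N, k ≠ j → dist (y j) (y k) ≤ 1 + t → ∀ l : Fin N, l ≠ k →
        (1 - t) ≤ dist (y k) (y l) ∧ (dist (y k) (y l) ≤ (1 + t) ∨ 63 / 50 ≤ dist (y k) (y l)))
    (pat : Set (EuclideanSpace ℝ (Fin 3)))
    (h : ∃ e : {w : EuclideanSpace ℝ (Fin 3) // w ∈ Set.range y ∧ w ≠ y j ∧ dist (y j) w ≤ 1 + t} ≃
        {q : EuclideanSpace ℝ (Fin 3) // q ∈ pat},
        ∀ w w' : {w : EuclideanSpace ℝ (Fin 3) // w ∈ Set.range y ∧ w ≠ y j ∧ dist (y j) w ≤ 1 + t},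
          w ≠ w' → (dist w.1 w'.1 ≤ 1 + t ↔ dist (e w).1 (e w').1 = 1)) :
    ∃ e : {k : Fin N // k ≠ j ∧ dist (y j) (y k) ≤ (1 + t')} ≃
        {q : EuclideanSpace ℝ (Fin 3) // q ∈ pat},
      ∀ k k' : {k : Fin N // k ≠ j ∧ dist (y j) (y k) ≤ (1 + t')}, k ≠ k' →
        (dist (y k.1) (y k'.1) ≤ (1 + t') ↔ dist (e k).1 (e k').1 = 1) := by
  obtain ⟨e, he⟩ := h
  -- the `t'`-neighbour indices of `j` are the `t`-neighbour indices (dichotomy at `j`)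
  have hdown : ∀ k : {k : Fin N // k ≠ j ∧ dist (y j) (y k) ≤ (1 + t')},
      dist (y j) (y k.1) ≤ 1 + t := fun k =>
    (dist_le_iff_of_dichotomy htt' ht' (hj k.1 k.2.1).2).1 k.2.2
  -- the forward map to the point-set neighbours
  let f : {k : Fin N // k ≠ j ∧ dist (y j) (y k) ≤ (1 + t')} →
      {w : EuclideanSpace ℝ (Fin 3) // w ∈ Set.range y ∧ w ≠ y j ∧ dist (y j) w ≤ 1 + t} :=
    fun k => ⟨y k.1, ⟨k.1, rfl⟩, hy.ne k.2.1, hdown k⟩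
  have hf : Function.Bijective f := by
    refine ⟨fun k k' hkk' => Subtype.ext (hy (congrArg Subtype.val hkk')), ?_⟩
    rintro ⟨w, ⟨l, rfl⟩, hne, hd⟩
    exact ⟨⟨l, fun h => hne (h ▸ rfl), hd.trans (by linarith)⟩, rfl⟩
  refine ⟨(Equiv.ofBijective f hf).trans e, fun k k' hkk' => ?_⟩
  have hk : ∀ l : Fin N, l ≠ k.1 → (1 - t) ≤ dist (y k.1) (y l) ∧
      (dist (y k.1) (y l) ≤ (1 + t) ∨ 63 / 50 ≤ dist (y k.1) (y l)) := hnb k.1 k.2.1 (hdown k)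
  have hne' : k'.1 ≠ k.1 := fun h => hkk' (Subtype.ext h).symm
  rw [dist_le_iff_of_dichotomy htt' ht' (hk k'.1 hne').2]
  exact he (f k) (f k') (hf.1.ne hkk')

/-- **Shell graphs from `SoftLocalHales`.** In an injective configuration `y`, if every atom within
`1 + t` of atom `j` (including `j`) is `t`-kissed and the conclusion of `SoftLocalHales` holds at
tolerance `t`, then for every `t' ∈ [t, 13/50)` the soft contact graph at tolerance `t'` on the
neighbours of `j` is the fcc or the hcp pattern graph (index form, as in `BrittleBarlowRigidity`).
[folklore] -/
theorem shellIso_of_softLocalHales {N : ℕ} {y : Fin N → EuclideanSpace ℝ (Fin 3)}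
    (hy : Function.Injective y) {t t' : ℝ} (ht : 0 ≤ t) (htt' : t ≤ t') (ht' : 1 + t' < 63 / 50)
    (hSLH : ∀ (S : Set (EuclideanSpace ℝ (Fin 3))) (u : EuclideanSpace ℝ (Fin 3)), u ∈ S →
      (∀ v ∈ S, dist u v ≤ 1 + t → ((∀ w ∈ S, w ≠ v → 1 - t ≤ dist v w ∧
        (dist v w ≤ 1 + t ∨ 63 / 50 ≤ dist v w)) ∧ {w ∈ S | w ≠ v ∧ dist v w ≤ 1 + t}.ncard = 12)) →
      ((∃ e : {w : EuclideanSpace ℝ (Fin 3) // w ∈ S ∧ w ≠ u ∧ dist u w ≤ 1 + t} ≃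
          {q : EuclideanSpace ℝ (Fin 3) // q ∈ fccKissingPattern},
          ∀ w w' : {w : EuclideanSpace ℝ (Fin 3) // w ∈ S ∧ w ≠ u ∧ dist u w ≤ 1 + t}, w ≠ w' →
            (dist w.1 w'.1 ≤ 1 + t ↔ dist (e w).1 (e w').1 = 1)) ∨
        (∃ e : {w : EuclideanSpace ℝ (Fin 3) // w ∈ S ∧ w ≠ u ∧ dist u w ≤ 1 + t} ≃
          {q : EuclideanSpace ℝ (Fin 3) // q ∈ hcpKissingPattern},
          ∀ w w' : {w : EuclideanSpace ℝ (Fin 3) // w ∈ S ∧ w ≠ u ∧ dist u w ≤ 1 + t}, w ≠ w' →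
            (dist w.1 w'.1 ≤ 1 + t ↔ dist (e w).1 (e w').1 = 1))))
    (j : Fin N)
    (hall : ∀ m : Fin N, dist (y j) (y m) ≤ 1 + t →
      (∀ l : Fin N, l ≠ m → (1 - t) ≤ dist (y m) (y l) ∧
        (dist (y m) (y l) ≤ (1 + t) ∨ 63 / 50 ≤ dist (y m) (y l))) ∧
      Nat.card {l : Fin N // l ≠ m ∧ dist (y m) (y l) ≤ (1 + t)} = 12) :
    (∃ e : {k : Fin N // k ≠ j ∧ dist (y j) (y k) ≤ (1 + t')} ≃
        {q : EuclideanSpace ℝ (Fin 3) // q ∈ fccKissingPattern},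
        ∀ k k' : {k : Fin N // k ≠ j ∧ dist (y j) (y k) ≤ (1 + t')}, k ≠ k' →
          (dist (y k.1) (y k'.1) ≤ (1 + t') ↔ dist (e k).1 (e k').1 = 1)) ∨
      (∃ e : {k : Fin N // k ≠ j ∧ dist (y j) (y k) ≤ (1 + t')} ≃
        {q : EuclideanSpace ℝ (Fin 3) // q ∈ hcpKissingPattern},
        ∀ k k' : {k : Fin N // k ≠ j ∧ dist (y j) (y k) ≤ (1 + t')}, k ≠ k' →
          (dist (y k.1) (y k'.1) ≤ (1 + t') ↔ dist (e k).1 (e k').1 = 1)) := by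
  have hj := hall j (by rw [dist_self]; linarith)
  have hS := hSLH (Set.range y) (y j) ⟨j, rfl⟩ (by
    rintro v ⟨m, rfl⟩ hd
    exact kissed_range_of_kissed hy (hall m hd))
  have hnb : ∀ k : Fin N, k ≠ j → dist (y j) (y k) ≤ 1 + t → ∀ l : Fin N, l ≠ k →
      (1 - t) ≤ dist (y k) (y l) ∧ (dist (y k) (y l) ≤ (1 + t) ∨ 63 / 50 ≤ dist (y k) (y l)) :=
    fun k _ hd => (hall k hd).1
  rcases hS with h | h
  · exact Or.inl (shellIso_transport hy htt' ht' j hj.1 hnb _ h)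
  · exact Or.inr (shellIso_transport hy htt' ht' j hj.1 hnb _ h)

/-! ### Counting: bad atoms against non-kissed atoms -/

/-- **Packing transfer of smallness.** In an `r`-separated configuration `y` of `ℝ³` (`r > 0`), if
property `P i` holds as soon as every atom within `D ≥ 0` of atom `i` has property `Q`, then the
atoms failing `P` number at most `(2D/r + 1)³` times the atoms failing `Q`: each `¬P`-atom lies within
`D` of a `¬Q`-atom, and a `D`-ball holds at most `(2D/r + 1)³` atoms
(`card_le_of_separated_of_dist_le`). [folklore] -/
theorem natCard_not_le_mul_natCard_not {N : ℕ} (y : Fin N → EuclideanSpace ℝ (Fin 3)) {r : ℝ}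
    (hr : 0 < r) (hsep : ∀ k l : Fin N, k ≠ l → r ≤ dist (y k) (y l)) (P Q : Fin N → Prop)
    {D : ℝ} (hD : 0 ≤ D) (himp : ∀ i : Fin N, (∀ m : Fin N, dist (y i) (y m) ≤ D → Q m) → P i) :
    (Nat.card {i : Fin N // ¬ P i} : ℝ) ≤ (2 * D / r + 1) ^ 3 * Nat.card {m : Fin N // ¬ Q m} := by
  classical
  rw [Nat.subtype_card (Finset.univ.filter fun i => ¬ P i) (by simp),
    Nat.subtype_card (Finset.univ.filter fun m => ¬ Q m) (by simp)]
  set B := Finset.univ.filter fun i : Fin N => ¬ P i with hB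
  set K := Finset.univ.filter fun m : Fin N => ¬ Q m with hK
  -- every bad atom is within `D` of a non-`Q` atom
  have hcover : B ⊆ K.biUnion fun m => Finset.univ.filter fun i : Fin N => dist (y i) (y m) ≤ D := by
    intro i hi
    have hi' : ¬ P i := (Finset.mem_filter.1 hi).2
    have : ¬ ∀ m : Fin N, dist (y i) (y m) ≤ D → Q m := fun h => hi' (himp i h)
    push Not at this
    obtain ⟨m, hm, hQ⟩ := this
    exact Finset.mem_biUnion.2 ⟨m, Finset.mem_filter.2 ⟨Finset.mem_univ _, hQ⟩,
      Finset.mem_filter.2 ⟨Finset.mem_univ _, hm⟩⟩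
  -- a `D`-ball holds at most `(2D/r + 1)³` atoms
  have hball : ∀ m : Fin N,
      (((Finset.univ.filter fun i : Fin N => dist (y i) (y m) ≤ D).card : ℝ)) ≤
        (2 * D / r + 1) ^ 3 := by
    intro m
    set F := Finset.univ.filter fun i : Fin N => dist (y i) (y m) ≤ D with hF
    have hinj : Set.InjOn y F := fun k _ l _ hkl => by
      by_contra hne
      have := hsep k l hne
      rw [hkl, dist_self] at this
      exact absurd this (not_le.2 hr)
    rw [← Finset.card_image_of_injOn hinj]
    have := card_le_of_separated_of_dist_le (F.image y) (y m) hr hD ?_ ?_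
    · rwa [finrank_euclideanSpace_fin] at this
    · intro c hc
      obtain ⟨k, hk, rfl⟩ := Finset.mem_image.1 hc
      exact (Finset.mem_filter.1 hk).2
    · intro c hc c' hc' hne
      obtain ⟨k, -, rfl⟩ := Finset.mem_image.1 hc
      obtain ⟨l, -, rfl⟩ := Finset.mem_image.1 hc'
      exact hsep k l fun h => hne (h ▸ rfl)
  calc (B.card : ℝ)
      ≤ ((K.biUnion fun m => Finset.univ.filter fun i : Fin N => dist (y i) (y m) ≤ D).card : ℝ) := by
        exact_mod_cast Finset.card_le_card hcover
    _ ≤ ∑ m ∈ K, (((Finset.univ.filter fun i : Fin N => dist (y i) (y m) ≤ D).card : ℝ)) := by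
        exact_mod_cast Finset.card_biUnion_le
    _ ≤ ∑ _m ∈ K, (2 * D / r + 1) ^ 3 := Finset.sum_le_sum fun m _ => hball m
    _ = (2 * D / r + 1) ^ 3 * K.card := by rw [Finset.sum_const, nsmul_eq_mul, mul_comm]

/-! ### Good atoms from kissed balls -/

/-- **An atom whose `6`-ball is `t`-kissed is good for `BrittleBarlowRigidity` at any tolerance
`t' ∈ [t, 13/50)`** (given the conclusion of `SoftLocalHales` at tolerance `t ≥ 0`): every atom `j`
within `4` of it is `t'`-kissed (`kissed_mono`) and has an fcc/hcp soft contact graph at tolerance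
`t'` (`shellIso_of_softLocalHales`, since the `(1 + t)`-ball of `j` lies in the `6`-ball of `i`).
[folklore] -/
theorem good_of_ball_kissed {N : ℕ} {y : Fin N → EuclideanSpace ℝ (Fin 3)}
    (hy : Function.Injective y) {t t' : ℝ} (ht : 0 ≤ t) (htt' : t ≤ t') (ht' : 1 + t' < 63 / 50)
    (hSLH : ∀ (S : Set (EuclideanSpace ℝ (Fin 3))) (u : EuclideanSpace ℝ (Fin 3)), u ∈ S →
      (∀ v ∈ S, dist u v ≤ 1 + t → ((∀ w ∈ S, w ≠ v → 1 - t ≤ dist v w ∧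
        (dist v w ≤ 1 + t ∨ 63 / 50 ≤ dist v w)) ∧ {w ∈ S | w ≠ v ∧ dist v w ≤ 1 + t}.ncard = 12)) →
      ((∃ e : {w : EuclideanSpace ℝ (Fin 3) // w ∈ S ∧ w ≠ u ∧ dist u w ≤ 1 + t} ≃
          {q : EuclideanSpace ℝ (Fin 3) // q ∈ fccKissingPattern},
          ∀ w w' : {w : EuclideanSpace ℝ (Fin 3) // w ∈ S ∧ w ≠ u ∧ dist u w ≤ 1 + t}, w ≠ w' →
            (dist w.1 w'.1 ≤ 1 + t ↔ dist (e w).1 (e w').1 = 1)) ∨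
        (∃ e : {w : EuclideanSpace ℝ (Fin 3) // w ∈ S ∧ w ≠ u ∧ dist u w ≤ 1 + t} ≃
          {q : EuclideanSpace ℝ (Fin 3) // q ∈ hcpKissingPattern},
          ∀ w w' : {w : EuclideanSpace ℝ (Fin 3) // w ∈ S ∧ w ≠ u ∧ dist u w ≤ 1 + t}, w ≠ w' →
            (dist w.1 w'.1 ≤ 1 + t ↔ dist (e w).1 (e w').1 = 1))))
    (i : Fin N)
    (hball : ∀ m : Fin N, dist (y i) (y m) ≤ 6 →
      (∀ l : Fin N, l ≠ m → (1 - t) ≤ dist (y m) (y l) ∧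
        (dist (y m) (y l) ≤ (1 + t) ∨ 63 / 50 ≤ dist (y m) (y l))) ∧
      Nat.card {l : Fin N // l ≠ m ∧ dist (y m) (y l) ≤ (1 + t)} = 12) :
    ∀ j : Fin N, dist (y i) (y j) ≤ 4 →
      (((∀ l : Fin N, l ≠ j → (1 - t') ≤ dist (y j) (y l) ∧
          (dist (y j) (y l) ≤ (1 + t') ∨ 63 / 50 ≤ dist (y j) (y l))) ∧
        Nat.card {l : Fin N // l ≠ j ∧ dist (y j) (y l) ≤ (1 + t')} = 12) ∧
      ((∃ e : {k : Fin N // k ≠ j ∧ dist (y j) (y k) ≤ (1 + t')} ≃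
          {q : EuclideanSpace ℝ (Fin 3) // q ∈ fccKissingPattern},
          ∀ k k' : {k : Fin N // k ≠ j ∧ dist (y j) (y k) ≤ (1 + t')}, k ≠ k' →
            (dist (y k.1) (y k'.1) ≤ (1 + t') ↔ dist (e k).1 (e k').1 = 1)) ∨
        (∃ e : {k : Fin N // k ≠ j ∧ dist (y j) (y k) ≤ (1 + t')} ≃
          {q : EuclideanSpace ℝ (Fin 3) // q ∈ hcpKissingPattern},
          ∀ k k' : {k : Fin N // k ≠ j ∧ dist (y j) (y k) ≤ (1 + t')}, k ≠ k' →
            (dist (y k.1) (y k'.1) ≤ (1 + t') ↔ dist (e k).1 (e k').1 = 1)))) := by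
  intro j hj
  have hall : ∀ m : Fin N, dist (y j) (y m) ≤ 1 + t →
      (∀ l : Fin N, l ≠ m → (1 - t) ≤ dist (y m) (y l) ∧
        (dist (y m) (y l) ≤ (1 + t) ∨ 63 / 50 ≤ dist (y m) (y l))) ∧
      Nat.card {l : Fin N // l ≠ m ∧ dist (y m) (y l) ≤ (1 + t)} = 12 := fun m hm =>
    hball m (by linarith [dist_triangle (y i) (y j) (y m)])
  exact ⟨kissed_mono y htt' ht' j (hall j (by rw [dist_self]; linarith)),
    shellIso_of_softLocalHales hy ht htt' ht' hSLH j hall⟩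

/-! ### The rung from the chain -/

/-- **The brittle rung from the rung chain** (the glue `RungAssembly` of route `BrittleRungDescent`,
conditional form of item `MieRung`): `SoftLocalHales → LadderGroundStates → MieSoftKissing →
BrittleBarlowRigidity → MieRung`.  With `η₀` from `SoftLocalHales`, `(η₁, p₁)` from
`BrittleBarlowRigidity`, `η = min η₀ η₁ ≤ 1/100`, `p₀ = p₀(η)` from `MieSoftKissing` and `q₀'` from
`LadderGroundStates`, every `q ≥ max (max p₀ p₁) (max q₀' 4)` works: ground states exist and are
`1/2`-separated (`1 - 2/q ≥ 1/2`), the atoms that are bad for `BrittleBarlowRigidity` at tolerance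
`η₁` number at most `25³` times the non-`η`-kissed atoms (`good_of_ball_kissed`,
`natCard_not_le_mul_natCard_not`), and the latter are `o(N)`. [folklore] -/
theorem mieRung_of_rung_chain :
    SoftLocalHales → LadderGroundStates → MieSoftKissing → BrittleBarlowRigidity → MieRung := by
  intro hSLH hLGS hMSK hBBR
  dsimp only [SoftLocalHales, LadderGroundStates, MieSoftKissing, BrittleBarlowRigidity] at hSLH hLGS hMSK hBBR
  obtain ⟨η₀, hη₀, hSLH⟩ := hSLH
  obtain ⟨η₁, hη₁, hη₁1, p₁, hBBR⟩ := hBBR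
  obtain ⟨q₁, hLGS⟩ := hLGS
  obtain ⟨p₀, hMSK⟩ := hMSK (min η₀ η₁) (lt_min hη₀ hη₁) ((min_le_right _ _).trans hη₁1)
  refine ⟨max (max p₀ p₁) (max q₁ 4), fun q hq => ?_⟩
  have hp₀ : p₀ ≤ q := le_trans (le_max_left _ _) ((le_max_left _ _).trans hq)
  have hp₁ : p₁ ≤ q := le_trans (le_max_right _ _) ((le_max_left _ _).trans hq)
  have hq₁ : q₁ ≤ q := le_trans (le_max_left _ _) ((le_max_right _ _).trans hq)
  have hq4 : 4 ≤ q := le_trans (le_max_right _ _) ((le_max_right _ _).trans hq)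
  obtain ⟨hex, hsep⟩ := hLGS q hq₁
  refine hBBR q hp₁ hex fun x hx => ?_
  have hK := hMSK q hp₀ x hx
  -- constants
  have hηt : (0 : ℝ) ≤ min η₀ η₁ := (lt_min hη₀ hη₁).le
  have hgap : 1 + η₁ < 63 / 50 := by linarith
  have hhalf : (1 : ℝ) / 2 ≤ 1 - 2 / (q : ℝ) := by
    have hq4' : (4 : ℝ) ≤ q := by exact_mod_cast hq4
    have h2 : 2 / (q : ℝ) ≤ 1 / 2 := by
      rw [div_le_iff₀ (by linarith)]
      linarith
    linarith
  -- the per-`N` packing estimate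
  have hle : ∀ N : ℕ,
      (Nat.card {i : Fin N // ¬ ∀ j : Fin N, dist (x N i) (x N j) ≤ 4 →
        (((∀ l : Fin N, l ≠ j → (1 - η₁) ≤ dist (x N j) (x N l) ∧
            (dist (x N j) (x N l) ≤ (1 + η₁) ∨ 63 / 50 ≤ dist (x N j) (x N l))) ∧
          Nat.card {l : Fin N // l ≠ j ∧ dist (x N j) (x N l) ≤ (1 + η₁)} = 12) ∧
        ((∃ e : {k : Fin N // k ≠ j ∧ dist (x N j) (x N k) ≤ (1 + η₁)} ≃
            {q : EuclideanSpace ℝ (Fin 3) // q ∈ fccKissingPattern},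
            ∀ k k' : {k : Fin N // k ≠ j ∧ dist (x N j) (x N k) ≤ (1 + η₁)}, k ≠ k' →
              (dist (x N k.1) (x N k'.1) ≤ (1 + η₁) ↔ dist (e k).1 (e k').1 = 1)) ∨
          (∃ e : {k : Fin N // k ≠ j ∧ dist (x N j) (x N k) ≤ (1 + η₁)} ≃
            {q : EuclideanSpace ℝ (Fin 3) // q ∈ hcpKissingPattern},
            ∀ k k' : {k : Fin N // k ≠ j ∧ dist (x N j) (x N k) ≤ (1 + η₁)}, k ≠ k' →
              (dist (x N k.1) (x N k'.1) ≤ (1 + η₁) ↔ dist (e k).1 (e k').1 = 1))))} : ℝ) / N ≤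
      (2 * 6 / (1 / 2) + 1) ^ 3 *
        ((Nat.card {i : Fin N // ¬ ((∀ j : Fin N, j ≠ i → (1 - min η₀ η₁) ≤ dist (x N i) (x N j) ∧
            (dist (x N i) (x N j) ≤ (1 + min η₀ η₁) ∨ 63 / 50 ≤ dist (x N i) (x N j))) ∧
          Nat.card {j : Fin N // j ≠ i ∧ dist (x N i) (x N j) ≤ (1 + min η₀ η₁)} = 12)} : ℝ) / N) := by
    intro N
    rw [← mul_div_assoc]
    refine div_le_div_of_nonneg_right ?_ (Nat.cast_nonneg N)
    refine natCard_not_le_mul_natCard_not (x N) (by norm_num : (0 : ℝ) < 1 / 2)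
      (fun k l hkl => hhalf.trans (hsep N (x N) (hx N) k l hkl)) _ _ (by norm_num : (0 : ℝ) ≤ 6)
      fun i hi => ?_
    exact good_of_ball_kissed (hx N).1 hηt (min_le_right η₀ η₁) hgap
      (hSLH (min η₀ η₁) (lt_min hη₀ hη₁) (min_le_left _ _)) i hi
  refine squeeze_zero (fun N => by positivity) hle ?_
  simpa using hK.const_mul ((2 * 6 / (1 / 2) + 1) ^ 3 : ℝ)

end Summit.AtomisticToContinuum.Crystallization.Theorems.BrittleRungDescentMieRung

end
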